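import Summits.Ventures.Crystal3D.Theorems.StickyWulffConstantTextureLiminfTexShadowLevelReachHexagonRow
import Summits.Ventures.Crystal3D.Theorems.StickyWulffConstantCoaxialWallLawOneFccMirrorCell
import HarnessLib

/-!
# The TOP plate's own (downward) cut hexagon census, by REFLECTING THE CELL — stated in the original coordinates
# (lane T, crux `TextureLiminfV5`, stmt-Ventures-23912, registered stub `stub_terraceCensus`; (β) plates side — HOME/wall-p1-g22/BETA-CUT-g22.md §5 (2) «then the top plate's own census by reflecting the cell»)

HONEST FRAMING. Venture `Summits/Ventures/Crystal3D` (cell `crystal3d-full`), route `route-Ventures-StickyWulffConstant`, helper `--supports` the law-v5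
crux `TextureLiminfV5` (stmt-Ventures-23912), lane T.  Census-free and certificate-free: the payer-side input is lane F's ABSTRACT local row
`LocalEndRowA` BY NAME (any constant `sF`, any second system), here for the REFLECTED root system `⟨G₂ ≫ bM, inPlaneRoots (G₂ ≫ bM) 1⟩`;
`KissingGap δ` / `KissingClassification δ` by name.  Nothing about energies; F-C1 not moved.

THE POINT.  In the two-plate cell (clamped Barlow bottom plate `stacking L₁ s₁ σ₁`, clamped Barlow top plate `stacking L₂ s₂ σ₂`, any Hägg words) the
TOP plate's hexagon lines run DOWNWARD along the falling in-plane roots `r ∈ inPlaneRoots G₂ (−1)` of a top frame `G₂ ∈ {L₂, bM ≫ L₂}` (type `t'`).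
Every census file is written for a bottom source, so the census is run in the MIRRORED cell `M(X)`, `M p = bM p + h·e₃` (lane F's '…OneFccMirrorCell':
`mirrorCell_separated`, `mirrorCell_plate_bottom/top`, `mirrorCell_deg_eq`), where the top plate is the clamped bottom plate `stacking (L₂ ≫ bM) (M s₂) σ₂` with
root frame `G₂ ≫ bM` (rising), and `hexagon_barlow_sources_le_payers_cuts` (…LevelReachHexagonRow) applies verbatim; then EVERY TERM IS PULLED BACK:
* sources: top-band balls `h+(R₀+1)+1 ≤ p₂ ≤ h+(R₀+1)+2` of the top plate on `t'`-admissible layers with `−(R₀+1)−1 < (p + G₂ r)₂ < h+(R₀+1)+1`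
  (`card_topSources_mirror`);
* payers: the SAME widened-window payer sum (`mirrorCell_payerSum₁₁_eq`: degrees and the window are `M`-invariant);
* cuts: readings `IsTwinReading X G₂ (G₂ μ) b` with `b − G₂ r ∈ X` in the window `−(R₀+1)−1 < b₂ ≤ h+(R₀+1)+1` (`isTwinReading_mirror_iff`: twin readings are
  transported by the cell mirror, `(X, G, m, b) ↦ (M X, G ≫ bM, bM m, M b)`);
* rims: the two lateral rims with the height bands reflected.
**`hexagon_barlow_sources_le_payers_cuts_top`** (counts) and **`hexagon_barlow_flux_le_payers_cuts_top`** (lane F's flux `oneFcc_srcA_ge` in the mirrored cell,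
tilt `−ν₂`, phase `(L₂⁻¹s₂)₂ − hν₂`, slice height `h+(R₀+1)+1`, rises `−(G₂ r)₂`).  Together with …LevelReachHexagonRow this is the complete PLATES side of the
origins-based assembly (memo §4(c)): both plates' hexagon budgets against ONE payer sum, each modulo its located CUT term and O(ρ) rims.
WHAT THIS IS NOT: the row (a hypothesis), the CUT / rim bounds, the born-line supply, the currency glue, the assembly; F-C1 not moved.
-/

noncomputable section

namespace Summit.Ventures.Crystal3D.Theorems

open Summit.Ventures.Crystal3D Finset
open Literature.MathematicalPhysics.StatisticalMechanics (barlowPos barlowStacking IsHaggSeq barlowPos_mem basalMirror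
  basalMirror_apply_coord basalMirror_basalMirror)
open Summit.Ventures.Crystal3D.Cruxes.TextureLiminf.TexShadow (E3 stacking)
open scoped InnerProductSpace

/-- A third-coordinate of a `G ≫ bM` image is minus that of the `G` image. -/
theorem trans_basalMirror_apply_two (G : E3 ≃ₗᵢ[ℝ] E3) (v : E3) : ((G.trans basalMirror) v) 2 = -(G v) 2 := by
  rw [LinearIsometryEquiv.trans_apply, (basalMirror_coords (G v)).2.2]

/-- The RISING in-plane roots of `G ≫ bM` are the FALLING in-plane roots of `G`. -/
theorem inPlaneRoots_trans_basalMirror (G : E3 ≃ₗᵢ[ℝ] E3) :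
    inPlaneRoots (G.trans basalMirror) 1 = inPlaneRoots G (-1) := by
  unfold inPlaneRoots
  refine filter_congr fun r _ => ?_
  rw [trans_basalMirror_apply_two]
  constructor
  · rintro ⟨hr, hup⟩; exact ⟨hr, by linarith⟩
  · rintro ⟨hr, hup⟩; exact ⟨hr, by linarith⟩

/-- The dozen of `G ≫ bM` is the `bM`-image of the dozen of `G`. -/
theorem image_slots_trans_basalMirror (G : E3 ≃ₗᵢ[ℝ] E3) :
    ((G.trans basalMirror : E3 ≃ₗᵢ[ℝ] E3) : E3 → E3) '' ↑fccSlots = basalMirror '' ((G : E3 → E3) '' ↑fccSlots) := by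
  rw [← Set.image_comp]; rfl

/-- `bM`-images of two dozens differ iff the dozens differ. -/
theorem image_basalMirror_ne {A B : Set E3} (hne : A ≠ B) : basalMirror '' A ≠ basalMirror '' B := fun heq =>
  hne (by
    have := congrArg (Set.image (basalMirror : E3 → E3)) heq
    rwa [← Set.image_comp, ← Set.image_comp, show ((basalMirror : E3 → E3) ∘ (basalMirror : E3 → E3)) = id from
      funext fun x => basalMirror_basalMirror x, Set.image_id, Set.image_id] at this)

/-- **Twin readings are transported by the cell mirror**: `(X, G, m, b) ↦ (M X, G ≫ bM, bM m, M b)`. -/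
theorem isTwinReading_mirror_iff (X : Finset E3) (h : ℝ) (G : E3 ≃ₗᵢ[ℝ] E3) (m b : E3) :
    IsTwinReading (X.image (fun q => basalMirror q + h • EuclideanSpace.single (2 : Fin 3) (1 : ℝ))) (G.trans basalMirror)
        (basalMirror m) (basalMirror b + h • EuclideanSpace.single (2 : Fin 3) (1 : ℝ)) ↔ IsTwinReading X G m b := by
  have key : ∀ v : E3, basalMirror b + h • EuclideanSpace.single (2 : Fin 3) (1 : ℝ) + v ∈
      X.image (fun q => basalMirror q + h • EuclideanSpace.single (2 : Fin 3) (1 : ℝ)) ↔ b + basalMirror v ∈ X := by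
    intro v
    have e : basalMirror b + h • EuclideanSpace.single (2 : Fin 3) (1 : ℝ) + v =
        basalMirror (b + basalMirror v) + h • EuclideanSpace.single (2 : Fin 3) (1 : ℝ) := by
      rw [map_add, basalMirror_basalMirror]; abel
    rw [e, mem_image_mirror_iff, mirror_mirror]
  have hin : ∀ w, ⟪(G.trans basalMirror) w, basalMirror m⟫_ℝ = ⟪G w, m⟫_ℝ := fun w => by
    rw [LinearIsometryEquiv.trans_apply, LinearIsometryEquiv.inner_map_map]
  have hsl : ∀ w, basalMirror ((G.trans basalMirror) w) = G w := fun w => by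
    rw [LinearIsometryEquiv.trans_apply, basalMirror_basalMirror]
  have hmi : ∀ w (c : ℝ), basalMirror ((G.trans basalMirror) w - c • basalMirror m) = G w - c • m := fun w c => by
    rw [map_sub, LinearIsometryEquiv.map_smul, hsl, basalMirror_basalMirror]
  simp only [IsTwinReading, IsMenuNormal, hin, key, hsl, hmi, LinearIsometryEquiv.norm_map]

/-- Membership of a mirror-translate in the mirrored configuration. -/
theorem mirror_add_mem_image_iff (X : Finset E3) (h : ℝ) (b v : E3) :
    basalMirror b + h • EuclideanSpace.single (2 : Fin 3) (1 : ℝ) + v ∈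
      X.image (fun q => basalMirror q + h • EuclideanSpace.single (2 : Fin 3) (1 : ℝ)) ↔ b + basalMirror v ∈ X := by
  have e : basalMirror b + h • EuclideanSpace.single (2 : Fin 3) (1 : ℝ) + v =
      basalMirror (b + basalMirror v) + h • EuclideanSpace.single (2 : Fin 3) (1 : ℝ) := by
    rw [map_add, basalMirror_basalMirror]; abel
  rw [e, mem_image_mirror_iff, mirror_mirror]

open scoped Classical in
/-- **The payer sum over the widened window is mirror-invariant** (window `[−(R₀+1)−2, h+(R₀+1)+2]`, payers `deg ≤ 11`). -/
theorem mirrorCell_payerSum₁₁_eq (X : Finset E3) (R₀ h : ℝ) :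
    ∑ z ∈ (X.image (fun q => basalMirror q + h • EuclideanSpace.single (2 : Fin 3) (1 : ℝ))).filter (fun z =>
        ((X.image (fun q => basalMirror q + h • EuclideanSpace.single (2 : Fin 3) (1 : ℝ))).filter fun q => dist z q = 1).card ≤ 11 ∧
          -(R₀ + 1) - 2 ≤ z 2 ∧ z 2 ≤ h + (R₀ + 1) + 2),
        ((12 : ℝ) - (((X.image (fun q => basalMirror q + h • EuclideanSpace.single (2 : Fin 3) (1 : ℝ))).filter
          fun q => dist z q = 1).card : ℝ)) =
      ∑ z ∈ X.filter (fun z => (X.filter fun q => dist z q = 1).card ≤ 11 ∧ -(R₀ + 1) - 2 ≤ z 2 ∧ z 2 ≤ h + (R₀ + 1) + 2),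
        ((12 : ℝ) - ((X.filter fun q => dist z q = 1).card : ℝ)) := by
  rw [filter_image, sum_image fun a _ b _ hab => mirror_injective h hab]
  refine sum_congr (filter_congr fun x _ => ?_) fun x _ => by rw [mirrorCell_deg_eq]
  show ((X.image (fun q => basalMirror q + h • EuclideanSpace.single (2 : Fin 3) (1 : ℝ))).filter fun q =>
      dist (basalMirror x + h • EuclideanSpace.single (2 : Fin 3) (1 : ℝ)) q = 1).card ≤ 11 ∧
      -(R₀ + 1) - 2 ≤ (basalMirror x + h • EuclideanSpace.single (2 : Fin 3) (1 : ℝ)) 2 ∧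
      (basalMirror x + h • EuclideanSpace.single (2 : Fin 3) (1 : ℝ)) 2 ≤ h + (R₀ + 1) + 2 ↔ _
  rw [mirrorCell_deg_eq, mirror_apply_two]
  constructor
  · rintro ⟨h1, h2, h3⟩; exact ⟨h1, by linarith, by linarith⟩
  · rintro ⟨h1, h2, h3⟩; exact ⟨h1, by linarith, by linarith⟩

/-- A filter of the mirrored configuration has the cardinality of the pulled-back filter. -/
theorem card_filter_mirror (X : Finset E3) (h : ℝ) (p : E3 → Prop) [DecidablePred p] :
    ((X.image (fun q => basalMirror q + h • EuclideanSpace.single (2 : Fin 3) (1 : ℝ))).filter p).card =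
      (X.filter fun q => p (basalMirror q + h • EuclideanSpace.single (2 : Fin 3) (1 : ℝ))).card := by
  rw [filter_image, card_image_of_injective _ (mirror_injective h)]

open scoped Classical in
/-- The TOP plate's source count along a falling root `G₂ r`, read in the mirrored cell (bottom form, root frame `G₂ ≫ bM`),
equals its count in the original coordinates. -/
theorem card_topSources_mirror (P₂ : Finset E3) (L₂ G₂ : E3 ≃ₗᵢ[ℝ] E3) (s₂ : E3) (σ₂ : ℤ → ℤ) (t' : ℤ) (R₀ h ρ : ℝ) (r : E3) :
    (((P₂.image (fun q => basalMirror q + h • EuclideanSpace.single (2 : Fin 3) (1 : ℝ))).filter fun p =>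
        -(R₀ + 1) - 1 - 1 ≤ p 2 ∧ p 2 ≤ -(R₀ + 1) - 1 ∧ p 0 ^ 2 + p 1 ^ 2 ≤ (ρ - 1 - 1) ^ 2).filter fun p =>
        (∃ k i j : ℤ, p = (L₂.trans basalMirror) (barlowPos 1 (Real.sqrt (2 / 3)) σ₂ k i j) +
            (basalMirror s₂ + h • EuclideanSpace.single (2 : Fin 3) (1 : ℝ)) ∧ ¬ (σ₂ (k - 1) = -t' ∧ σ₂ k = -t')) ∧
          -(R₀ + 1) - 1 < (p + (G₂.trans basalMirror) r) 2 ∧ (p + (G₂.trans basalMirror) r) 2 < h + (R₀ + 1) + 1).card =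
      ((P₂.filter fun p => h + (R₀ + 1) + 1 ≤ p 2 ∧ p 2 ≤ h + (R₀ + 1) + 1 + 1 ∧ p 0 ^ 2 + p 1 ^ 2 ≤ (ρ - 1 - 1) ^ 2).filter
          fun p => (∃ k i j : ℤ, p = L₂ (barlowPos 1 (Real.sqrt (2 / 3)) σ₂ k i j) + s₂ ∧ ¬ (σ₂ (k - 1) = -t' ∧ σ₂ k = -t')) ∧
            -(R₀ + 1) - 1 < (p + G₂ r) 2 ∧ (p + G₂ r) 2 < h + (R₀ + 1) + 1).card := by
  set cM : E3 := h • EuclideanSpace.single (2 : Fin 3) (1 : ℝ) with hcM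
  set M : E3 → E3 := fun q => basalMirror q + cM with hM
  have hMinj : Function.Injective M := mirror_injective h
  have hM2 : ∀ p, M p 2 = h - p 2 := fun p => mirror_apply_two h p
  have hMlat : ∀ p, M p 0 ^ 2 + M p 1 ^ 2 = p 0 ^ 2 + p 1 ^ 2 := fun p => mirror_lat h p
  have hMs : basalMirror s₂ + cM = M s₂ := rfl
  rw [hMs, filter_filter, filter_filter, filter_image, card_image_of_injective _ hMinj]
  refine congrArg _ (filter_congr fun p _ => ?_)
  have hrep : ∀ k i j : ℤ, (M p = (L₂.trans basalMirror) (barlowPos 1 (Real.sqrt (2 / 3)) σ₂ k i j) + M s₂ ↔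
      p = L₂ (barlowPos 1 (Real.sqrt (2 / 3)) σ₂ k i j) + s₂) := by
    intro k i j
    have e : (L₂.trans basalMirror) (barlowPos 1 (Real.sqrt (2 / 3)) σ₂ k i j) + M s₂ =
        M (L₂ (barlowPos 1 (Real.sqrt (2 / 3)) σ₂ k i j) + s₂) := by
      simp only [hM, LinearIsometryEquiv.trans_apply, map_add]; abel
    rw [e]
    exact ⟨fun hh => hMinj hh, fun hh => by rw [hh]⟩
  have hcr : (M p + (G₂.trans basalMirror) r) 2 = h - (p + G₂ r) 2 := by
    rw [PiLp.add_apply, hM2, trans_basalMirror_apply_two, PiLp.add_apply]; ring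
  simp only [hrep, hcr, hM2, hMlat]
  constructor
  · rintro ⟨⟨h1, h2, h3⟩, h4, h5, h6⟩; exact ⟨⟨by linarith, by linarith, h3⟩, h4, by linarith, by linarith⟩
  · rintro ⟨⟨h1, h2, h3⟩, h4, h5, h6⟩; exact ⟨⟨by linarith, by linarith, h3⟩, h4, by linarith, by linarith⟩

open scoped Classical in
/-- **The TOP plate's own (downward) cut hexagon census under an abstract local row** — the reflected twin of
`hexagon_barlow_sources_le_payers_cuts`, stated in the ORIGINAL coordinates.  See the module docstring. -/
theorem hexagon_barlow_sources_le_payers_cuts_top (ver : WordVersion) {δ : ℝ} (hg : KissingGap δ) (hc : KissingClassification δ)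
    {σ₁ σ₂ : ℤ → ℤ} (hσ₁ : IsHaggSeq σ₁) (hσ₂ : IsHaggSeq σ₂) (L₁ L₂ : E3 ≃ₗᵢ[ℝ] E3) (s₁ s₂ : E3)
    (G₂ : E3 ≃ₗᵢ[ℝ] E3) {t' : ℤ} (hG₂ : (t' = 1 ∧ G₂ = L₂) ∨ (t' = -1 ∧ G₂ = basalMirror.trans L₂))
    (hne₁ : (G₂ : E3 → E3) '' ↑fccSlots ≠ (L₁ : E3 → E3) '' ↑fccSlots)
    (hne₂ : (G₂ : E3 → E3) '' ↑fccSlots ≠ ((basalMirror.trans L₁ : E3 ≃ₗᵢ[ℝ] E3) : E3 → E3) '' ↑fccSlots)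
    {sF : ℝ} (S₂ : PlateSystem)
    (hrow : LocalEndRowA ver sF ⟨G₂.trans basalMirror, inPlaneRoots (G₂.trans basalMirror) 1⟩ S₂)
    (X P₁ P₂ : Finset E3) (R₀ h ρ : ℝ) (hR₀ : 5 ≤ R₀) (hρ : R₀ + 2 ≤ ρ)
    (hX : ∀ p ∈ X, ∀ q ∈ X, p ≠ q → 1 ≤ dist p q) (hP₁X : P₁ ⊆ X) (hP₂X : P₂ ⊆ X)
    (hP₁ : ∀ p, p ∈ P₁ ↔ (p ∈ stacking L₁ s₁ σ₁ ∧ -(2 * R₀) ≤ p 2 ∧ p 2 ≤ -R₀ ∧ p 0 ^ 2 + p 1 ^ 2 ≤ ρ ^ 2))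
    (hP₂ : ∀ p, p ∈ P₂ ↔ (p ∈ stacking L₂ s₂ σ₂ ∧ h + R₀ ≤ p 2 ∧ p 2 ≤ h + 2 * R₀ ∧ p 0 ^ 2 + p 1 ^ 2 ≤ ρ ^ 2)) :
    ((∑ r ∈ inPlaneRoots G₂ (-1),
        ((P₂.filter fun p => h + (R₀ + 1) + 1 ≤ p 2 ∧ p 2 ≤ h + (R₀ + 1) + 1 + 1 ∧ p 0 ^ 2 + p 1 ^ 2 ≤ (ρ - 1 - 1) ^ 2).filter
          fun p => (∃ k i j : ℤ, p = L₂ (barlowPos 1 (Real.sqrt (2 / 3)) σ₂ k i j) + s₂ ∧ ¬ (σ₂ (k - 1) = -t' ∧ σ₂ k = -t')) ∧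
            -(R₀ + 1) - 1 < (p + G₂ r) 2 ∧ (p + G₂ r) 2 < h + (R₀ + 1) + 1).card : ℕ) : ℝ) ≤
      sF * ∑ z ∈ X.filter (fun z => (X.filter fun q => dist z q = 1).card ≤ 11 ∧
          -(R₀ + 1) - 2 ≤ z 2 ∧ z 2 ≤ h + (R₀ + 1) + 2), ((12 : ℝ) - ((X.filter fun q => dist z q = 1).card : ℝ)) +
        ((∑ r ∈ inPlaneRoots G₂ (-1), (X.filter fun b => -(R₀ + 1) - 1 < b 2 ∧ b 2 ≤ h + (R₀ + 1) + 1 ∧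
            (∃ μ, ⟪r, μ⟫_ℝ = Real.sqrt (2 / 3) ∧ IsTwinReading X G₂ (G₂ μ) b) ∧ b - G₂ r ∈ X).card : ℕ) : ℝ) +
        ((inPlaneRoots G₂ (-1)).card : ℝ) *
          (220 * ((X.filter fun s => -(R₀ + 1) - 1 - 1 ≤ s 2 ∧ s 2 ≤ -(R₀ + 1) - 1 ∧
              (ρ - 1 - 2) ^ 2 < s 0 ^ 2 + s 1 ^ 2).card : ℝ) +
            220 * ((X.filter fun s => h + (R₀ + 1) + 1 < s 2 ∧ s 2 ≤ h + (R₀ + 1) + 1 + 1 ∧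
              (ρ - 1 - 1) ^ 2 < s 0 ^ 2 + s 1 ^ 2).card : ℝ)) := by
  set cM : E3 := h • EuclideanSpace.single (2 : Fin 3) (1 : ℝ) with hcM
  set M : E3 → E3 := fun q => basalMirror q + cM with hM
  set Fr' : E3 ≃ₗᵢ[ℝ] E3 := G₂.trans basalMirror with hFr'
  -- the cell mirror in `M`-form
  have hMinj : Function.Injective M := mirror_injective h
  have hM2 : ∀ p, M p 2 = h - p 2 := fun p => mirror_apply_two h p
  have hMlat : ∀ p, M p 0 ^ 2 + M p 1 ^ 2 = p 0 ^ 2 + p 1 ^ 2 := fun p => mirror_lat h p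
  have hcardM : ∀ (Y : Finset E3) (p : E3 → Prop) [DecidablePred p],
      ((Y.image M).filter p).card = (Y.filter fun q => p (M q)).card :=
    fun Y p _ => by rw [filter_image, card_image_of_injective _ hMinj]
  have hmemM : ∀ b v : E3, M b + v ∈ X.image M ↔ b + basalMirror v ∈ X := fun b v => mirror_add_mem_image_iff X h b v
  have hreadM : ∀ (m b : E3), IsTwinReading (X.image M) Fr' (basalMirror m) (M b) ↔ IsTwinReading X G₂ m b :=
    fun m b => isTwinReading_mirror_iff X h G₂ m b
  have hpayM : ∑ z ∈ (X.image M).filter (fun z => ((X.image M).filter fun q => dist z q = 1).card ≤ 11 ∧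
        -(R₀ + 1) - 2 ≤ z 2 ∧ z 2 ≤ h + (R₀ + 1) + 2), ((12 : ℝ) - (((X.image M).filter fun q => dist z q = 1).card : ℝ)) =
      ∑ z ∈ X.filter (fun z => (X.filter fun q => dist z q = 1).card ≤ 11 ∧ -(R₀ + 1) - 2 ≤ z 2 ∧ z 2 ≤ h + (R₀ + 1) + 2),
        ((12 : ℝ) - ((X.filter fun q => dist z q = 1).card : ℝ)) := mirrorCell_payerSum₁₁_eq X R₀ h
  -- the mirrored cell
  have hXsep' : ∀ p ∈ X.image M, ∀ q ∈ X.image M, p ≠ q → 1 ≤ dist p q := mirrorCell_separated X hX cM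
  have hP₁'X : P₂.image M ⊆ X.image M := image_subset_image hP₂X
  have hP₂'X : P₁.image M ⊆ X.image M := image_subset_image hP₁X
  have hP₁' : ∀ p, p ∈ P₂.image M ↔ (p ∈ stacking (L₂.trans basalMirror) (M s₂) σ₂ ∧
      -(2 * R₀) ≤ p 2 ∧ p 2 ≤ -R₀ ∧ p 0 ^ 2 + p 1 ^ 2 ≤ ρ ^ 2) := mirrorCell_plate_bottom P₂ L₂ s₂ σ₂ R₀ h ρ hP₂
  have hP₂' : ∀ p, p ∈ P₁.image M ↔ (p ∈ stacking (L₁.trans basalMirror) (M s₁) σ₁ ∧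
      h + R₀ ≤ p 2 ∧ p 2 ≤ h + 2 * R₀ ∧ p 0 ^ 2 + p 1 ^ 2 ≤ ρ ^ 2) := mirrorCell_plate_top P₁ L₁ s₁ σ₁ R₀ h ρ hP₁
  have hFr'cases : (t' = 1 ∧ Fr' = L₂.trans basalMirror) ∨ (t' = -1 ∧ Fr' = basalMirror.trans (L₂.trans basalMirror)) := by
    rcases hG₂ with ⟨ht, hG⟩ | ⟨ht, hG⟩
    · exact Or.inl ⟨ht, by rw [hFr', hG]⟩
    · exact Or.inr ⟨ht, by rw [hFr', hG]; exact LinearIsometryEquiv.ext fun x => rfl⟩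
  have hne₁' : (Fr' : E3 → E3) '' ↑fccSlots ≠ ((L₁.trans basalMirror : E3 ≃ₗᵢ[ℝ] E3) : E3 → E3) '' ↑fccSlots := by
    rw [hFr', image_slots_trans_basalMirror, image_slots_trans_basalMirror]; exact image_basalMirror_ne hne₁
  have hne₂' : (Fr' : E3 → E3) '' ↑fccSlots ≠
      ((basalMirror.trans (L₁.trans basalMirror) : E3 ≃ₗᵢ[ℝ] E3) : E3 → E3) '' ↑fccSlots := by
    have e : basalMirror.trans (L₁.trans basalMirror) = (basalMirror.trans L₁).trans basalMirror :=
      LinearIsometryEquiv.ext fun x => rfl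
    rw [hFr', e, image_slots_trans_basalMirror, image_slots_trans_basalMirror]; exact image_basalMirror_ne hne₂
  -- the census of the mirrored cell
  have h1 := hexagon_barlow_sources_le_payers_cuts ver hg hc hσ₂ hσ₁ (L₂.trans basalMirror) (L₁.trans basalMirror)
    (M s₂) (M s₁) Fr' hFr'cases hne₁' hne₂' S₂ hrow (X.image M) (P₂.image M) (P₁.image M) R₀ h ρ hR₀ hρ hXsep' hP₁'X hP₂'X
    hP₁' hP₂'
  -- transport of every term
  have hRT : inPlaneRoots Fr' 1 = inPlaneRoots G₂ (-1) := inPlaneRoots_trans_basalMirror G₂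
  have hFr'2 : ∀ v, (Fr' v) 2 = -(G₂ v) 2 := fun v => trans_basalMirror_apply_two G₂ v
  -- (a) the source counts
  have hsrc := card_topSources_mirror P₂ L₂ G₂ s₂ σ₂ t' R₀ h ρ
  -- (b) the cut terms
  have hcut : ∀ r, ((X.image M).filter fun b => -(R₀ + 1) - 1 ≤ b 2 ∧ b 2 < h + (R₀ + 1) + 1 ∧
        (∃ μ, ⟪r, μ⟫_ℝ = Real.sqrt (2 / 3) ∧ IsTwinReading (X.image M) Fr' (Fr' μ) b) ∧ b - Fr' r ∈ X.image M).card =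
      (X.filter fun b => -(R₀ + 1) - 1 < b 2 ∧ b 2 ≤ h + (R₀ + 1) + 1 ∧
        (∃ μ, ⟪r, μ⟫_ℝ = Real.sqrt (2 / 3) ∧ IsTwinReading X G₂ (G₂ μ) b) ∧ b - G₂ r ∈ X).card := by
    intro r
    rw [hcardM]
    refine congrArg _ (filter_congr fun b _ => ?_)
    have hread : ∀ μ, IsTwinReading (X.image M) Fr' (Fr' μ) (M b) ↔ IsTwinReading X G₂ (G₂ μ) b := fun μ => by
      have e : Fr' μ = basalMirror (G₂ μ) := by rw [hFr', LinearIsometryEquiv.trans_apply]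
      rw [e]; exact hreadM (G₂ μ) b
    have hpred : M b - Fr' r ∈ X.image M ↔ b - G₂ r ∈ X := by
      rw [sub_eq_add_neg, hmemM, map_neg, hFr', LinearIsometryEquiv.trans_apply, basalMirror_basalMirror, ← sub_eq_add_neg]
    simp only [hread, hpred, hM2]
    constructor
    · rintro ⟨h1, h2, h3, h4⟩; exact ⟨by linarith, by linarith, h3, h4⟩
    · rintro ⟨h1, h2, h3, h4⟩; exact ⟨by linarith, by linarith, h3, h4⟩
  -- (c) the rims
  have hrimT : ((X.image M).filter fun s => h + (R₀ + 1) + 1 ≤ s 2 ∧ s 2 ≤ h + (R₀ + 1) + 1 + 1 ∧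
        (ρ - 1 - 2) ^ 2 < s 0 ^ 2 + s 1 ^ 2).card =
      (X.filter fun s => -(R₀ + 1) - 1 - 1 ≤ s 2 ∧ s 2 ≤ -(R₀ + 1) - 1 ∧ (ρ - 1 - 2) ^ 2 < s 0 ^ 2 + s 1 ^ 2).card := by
    rw [hcardM]
    refine congrArg _ (filter_congr fun s _ => ?_)
    simp only [hM2, hMlat]
    constructor
    · rintro ⟨h1, h2, h3⟩; exact ⟨by linarith, by linarith, h3⟩
    · rintro ⟨h1, h2, h3⟩; exact ⟨by linarith, by linarith, h3⟩
  have hrimB : ((X.image M).filter fun s => -(R₀ + 1) - 1 - 1 ≤ s 2 ∧ s 2 < -(R₀ + 1) - 1 ∧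
        (ρ - 1 - 1) ^ 2 < s 0 ^ 2 + s 1 ^ 2).card =
      (X.filter fun s => h + (R₀ + 1) + 1 < s 2 ∧ s 2 ≤ h + (R₀ + 1) + 1 + 1 ∧ (ρ - 1 - 1) ^ 2 < s 0 ^ 2 + s 1 ^ 2).card := by
    rw [hcardM]
    refine congrArg _ (filter_congr fun s _ => ?_)
    simp only [hM2, hMlat]
    constructor
    · rintro ⟨h1, h2, h3⟩; exact ⟨by linarith, by linarith, h3⟩
    · rintro ⟨h1, h2, h3⟩; exact ⟨by linarith, by linarith, h3⟩
  -- (d) assemble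
  rw [hRT, sum_congr rfl fun r _ => hsrc r, sum_congr rfl fun r _ => hcut r, hrimT, hrimB, hpayM] at h1
  exact h1


open scoped Classical in
/-- **The FLUX form of the top plate's census.**  Lane F's `oneFcc_srcA_ge` in the mirrored cell, transported: the tilt of `L₂ ≫ bM` is `−ν₂`,
its plane phase `(L₂⁻¹ s₂)₂ − h ν₂` (`symm_e₃_two_trans_basalMirror`, `symm_two_trans_basalMirror_shift`), the slice is at height
`h + (R₀+1) + 1`, the rises are `−(G₂ r)₂ > 0` over the FALLING in-plane roots. -/
theorem hexagon_barlow_flux_le_payers_cuts_top (ver : WordVersion) {δ : ℝ} (hg : KissingGap δ) (hc : KissingClassification δ)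
    {σ₁ σ₂ : ℤ → ℤ} (hσ₁ : IsHaggSeq σ₁) (hσ₂ : IsHaggSeq σ₂) (L₁ L₂ : E3 ≃ₗᵢ[ℝ] E3) (s₁ s₂ : E3)
    (G₂ : E3 ≃ₗᵢ[ℝ] E3) {t' : ℤ} (hG₂ : (t' = 1 ∧ G₂ = L₂) ∨ (t' = -1 ∧ G₂ = basalMirror.trans L₂))
    (hne₁ : (G₂ : E3 → E3) '' ↑fccSlots ≠ (L₁ : E3 → E3) '' ↑fccSlots)
    (hne₂ : (G₂ : E3 → E3) '' ↑fccSlots ≠ ((basalMirror.trans L₁ : E3 ≃ₗᵢ[ℝ] E3) : E3 → E3) '' ↑fccSlots)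
    {sF : ℝ} (S₂ : PlateSystem)
    (hrow : LocalEndRowA ver sF ⟨G₂.trans basalMirror, inPlaneRoots (G₂.trans basalMirror) 1⟩ S₂)
    (X P₁ P₂ : Finset E3) (R₀ h ρ : ℝ) (hR₀ : 5 ≤ R₀) (hh : 0 ≤ h) (hρ : R₀ + 2 ≤ ρ)
    (hX : ∀ p ∈ X, ∀ q ∈ X, p ≠ q → 1 ≤ dist p q) (hP₁X : P₁ ⊆ X) (hP₂X : P₂ ⊆ X)
    (hP₁ : ∀ p, p ∈ P₁ ↔ (p ∈ stacking L₁ s₁ σ₁ ∧ -(2 * R₀) ≤ p 2 ∧ p 2 ≤ -R₀ ∧ p 0 ^ 2 + p 1 ^ 2 ≤ ρ ^ 2))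
    (hP₂ : ∀ p, p ∈ P₂ ↔ (p ∈ stacking L₂ s₂ σ₂ ∧ h + R₀ ≤ p 2 ∧ p 2 ≤ h + 2 * R₀ ∧ p 0 ^ 2 + p 1 ^ 2 ≤ ρ ^ 2))
    (Kw : Finset ℤ) :
    ∑ k ∈ Kw, (if ¬ (σ₂ (k - 1) = -t' ∧ σ₂ k = -t') then (1 : ℝ) else 0) *
        (4 * (∑ r ∈ inPlaneRoots G₂ (-1), -(G₂ r) 2) / (Real.sqrt 3 * (1 - (L₂.symm (EuclideanSpace.single (2 : Fin 3) (1 : ℝ))) 2 ^ 2)) *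
          Real.sqrt (max 0 ((ρ - 4) ^ 2 * (1 - (L₂.symm (EuclideanSpace.single (2 : Fin 3) (1 : ℝ))) 2 ^ 2) -
            ((k : ℝ) * Real.sqrt (2 / 3) + (L₂.symm s₂) 2 -
              (h + (R₀ + 1) + 1) * (L₂.symm (EuclideanSpace.single (2 : Fin 3) (1 : ℝ))) 2) ^ 2)) -
          ((inPlaneRoots G₂ (-1)).card : ℝ)) ≤
      sF * ∑ z ∈ X.filter (fun z => (X.filter fun q => dist z q = 1).card ≤ 11 ∧
          -(R₀ + 1) - 2 ≤ z 2 ∧ z 2 ≤ h + (R₀ + 1) + 2), ((12 : ℝ) - ((X.filter fun q => dist z q = 1).card : ℝ)) +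
        ((∑ r ∈ inPlaneRoots G₂ (-1), (X.filter fun b => -(R₀ + 1) - 1 < b 2 ∧ b 2 ≤ h + (R₀ + 1) + 1 ∧
            (∃ μ, ⟪r, μ⟫_ℝ = Real.sqrt (2 / 3) ∧ IsTwinReading X G₂ (G₂ μ) b) ∧ b - G₂ r ∈ X).card : ℕ) : ℝ) +
        ((inPlaneRoots G₂ (-1)).card : ℝ) *
          (220 * ((X.filter fun s => -(R₀ + 1) - 1 - 1 ≤ s 2 ∧ s 2 ≤ -(R₀ + 1) - 1 ∧
              (ρ - 1 - 2) ^ 2 < s 0 ^ 2 + s 1 ^ 2).card : ℝ) +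
            220 * ((X.filter fun s => h + (R₀ + 1) + 1 < s 2 ∧ s 2 ≤ h + (R₀ + 1) + 1 + 1 ∧
              (ρ - 1 - 1) ^ 2 < s 0 ^ 2 + s 1 ^ 2).card : ℝ)) := by
  have h1 := hexagon_barlow_sources_le_payers_cuts_top ver hg hc hσ₁ hσ₂ L₁ L₂ s₁ s₂ G₂ hG₂ hne₁ hne₂ S₂ hrow X P₁ P₂ R₀ h ρ
    hR₀ hρ hX hP₁X hP₂X hP₁ hP₂
  refine le_trans ?_ h1
  -- lane F's flux bound in the mirrored cell
  set Fr' : E3 ≃ₗᵢ[ℝ] E3 := G₂.trans basalMirror with hFr'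
  have hFr'cases : (t' = 1 ∧ Fr' = L₂.trans basalMirror) ∨ (t' = -1 ∧ Fr' = basalMirror.trans (L₂.trans basalMirror)) := by
    rcases hG₂ with ⟨ht, hG⟩ | ⟨ht, hG⟩
    · exact Or.inl ⟨ht, by rw [hFr', hG]⟩
    · exact Or.inr ⟨ht, by rw [hFr', hG]; exact LinearIsometryEquiv.ext fun x => rfl⟩
  have hP₁' := mirrorCell_plate_bottom P₂ L₂ s₂ σ₂ R₀ h ρ hP₂
  have h0 := oneFcc_srcA_ge (L₂.trans basalMirror) (basalMirror s₂ + h • EuclideanSpace.single (2 : Fin 3) (1 : ℝ)) Fr'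
    (fun r hr => frame_apply_basal hFr'cases hr) t'
    (P₂.image (fun q => basalMirror q + h • EuclideanSpace.single (2 : Fin 3) (1 : ℝ))) R₀ h ρ (by linarith) hh (by linarith) hP₁' Kw
  -- transport: roots, rises, tilt, phase, sources
  have hRT : inPlaneRoots Fr' 1 = inPlaneRoots G₂ (-1) := inPlaneRoots_trans_basalMirror G₂
  rw [hRT, sum_congr rfl fun r _ => card_topSources_mirror P₂ L₂ G₂ s₂ σ₂ t' R₀ h ρ r] at h0
  have hrise : ∑ r ∈ inPlaneRoots G₂ (-1), (Fr' r) 2 = ∑ r ∈ inPlaneRoots G₂ (-1), -(G₂ r) 2 :=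
    sum_congr rfl fun r _ => trans_basalMirror_apply_two G₂ r
  rw [hrise, symm_e₃_two_trans_basalMirror, symm_two_trans_basalMirror_shift, neg_sq] at h0
  have harg : ∀ k : ℤ, (k : ℝ) * Real.sqrt (2 / 3) + ((L₂.symm s₂) 2 - h * (L₂.symm (EuclideanSpace.single (2 : Fin 3) (1 : ℝ))) 2) -
      (-(R₀ + 1) - 1) * -(L₂.symm (EuclideanSpace.single (2 : Fin 3) (1 : ℝ))) 2 =
      (k : ℝ) * Real.sqrt (2 / 3) + (L₂.symm s₂) 2 - (h + (R₀ + 1) + 1) * (L₂.symm (EuclideanSpace.single (2 : Fin 3) (1 : ℝ))) 2 :=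
    fun k => by ring
  simp only [harg] at h0
  exact h0

end Summit.Ventures.Crystal3D.Theorems

end
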